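import Summits.BirchSwinnertonDyer.Rank1Residual.X11b.UnrSeriesIdealDescent
import Summits.BirchSwinnertonDyer.Rank1Residual.X11b.FrameIdealRigidity
import Summits.BirchSwinnertonDyer.Rank1Residual.X11b.BDPRouteOpenInputIdealRigidity
import Summits.BirchSwinnertonDyer.Rank1Residual.X11b.RouteP2OpenInputFromPrint
import HarnessLib

/-!
# Class X11b, route p2 at `p ≥ 5`: the open statement in PRINT CURRENCY — (2.4)∃♭ over
# `𝓞_{ℂ_p}⟦T⟧` IMPLIES the erratum's (2.4) `Ch_Λ(X_ac)·Λ_{R₀} ⊆ (L)` for EVERY `R₀`-frame with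
# `Ω_K ≠ 0`, and is EQUIVALENT to it on semistable pairs (cell `b2b-bsdres`, sub-cell `multr1-p2`,
# gen 26)

HONEST FRAMING (cell `b2b-bsdres`, run/shared/lean/b2b/bsd-rank1-residual/, verbatim in every
file): the goal of the cell is to DELETE the COMBINATION-SHAPED residual classes of the
Birch–Swinnerton-Dyer formula for ALL analytic-rank `≤ 1` elliptic curves over `ℚ` — "full BSD
formula for every rank `≤ 1` curve in class `C`" assembled STRICTLY from published theorems — so
that the rank-`≤ 1` remainder becomes exactly the CONSTRUCTION-SHAPED classes, which are TYPED
(missing-input `Prop`s), NOT attempted. This is not "finishing BSD". Sub-cell `multr1-p2` is a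
RESEARCH ROUTE on class X11b (`ClassX11b W p := r_an = 1 ∧ p ≠ 2 ∧ mult(p) ∧ irr(p)`,
`Partition/Rows.lean`); no claim beyond the stated class and loci; X11b's label does not change;
NOTHING is booked by this file.

ONE `Prop`-VALUED SHAPE (`P2.IMCDivAllUnrFramesOnTree` — OPEN, conjecture-tagged (gen 29; claim-tagged
in gens 26–28, see SCOPE below), nothing asserted: the erratum's (2.4) VERBATIM over Castella's
receptacle `Λ_{R₀} = R₀⟦T⟧`, for every `R₀`-frame with `Ω_K ≠ 0`) and THEOREMS. No named fact.

SCOPE OF THE ANNOUNCED DERIVATION (gen 29, doc + tag only; statements byte-identical; sources re-read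
verbatim). The shape below — like every classical-field `P2.` shape — is asked at CLASSICAL Heegner data
(`SatisfiesHeegnerHypothesis`: every `ℓ ∣ N_E` split in `K`). The derivation its gen-26 docstring
pointed at, the erratum's "(2.4) … By [FW21, Thm. 4.41]", carries Fouquet–Wan's hypothesis "there
exists `q ∥ N` (in particular `q ∤ p`) which is not split in `K`" (arXiv:2107.13726v3, Thm. 4.41, third
hypothesis; the full inclusion moreover wants every non-split `ℓ ∣ N` RAMIFIED in `K` with `π(f)_ℓ`
special Steinberg twisted by the unramified quadratic character), exactly as [Castella2018, p. 4]
("at least one prime `q ∣ N` nonsplit in `K`") and [Castella2024, Thm. 3.1 (iii)] do; classical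
Heegner data EXCLUDE such a `q`. So that derivation lives at route R1's ERRATUM fields and is typed
there (`P2.IMCDivIntFrameAtErratumData`, `X11b/BDPRouteErratumData.lean`, gen 28); at classical
Heegner fields the published result in this direction is [BurungaleCastellaSkinner2025, Thm. 1.2.4]
(`ch(X_Gr) = (L_p^BDP)`, primes `p > 3` of GOOD ORDINARY reduction), whose multiplicative analogue
(`p ∥ N`, this shape) is in no source the cell holds, and the only printed statement in this direction
at `p ∥ N` is STEP L itself ([SkinnerZhang2014] Thm. 1.2, PREPRINT; `indexLowerBoundAt_of_skinnerZhang_OPEN`).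
Hence: NO announced derivation at these data; the shape is an instance of the Iwasawa–Greenberg main
conjecture for `X_ac(E[p^∞])` ([Castella2018, §1 (1.b)], one inclusion) and is re-badged
`@[conjecture]`; every record using it was and stays CONDITIONAL on it; nothing else changes.

## Why (gen 26)

Gens 24–25 weakened route p2's ONE open statement to the ♭-currency `𝓞_{ℂ_p}⟦T⟧` — (2.4)∃♭
`P2.IMCDivSomeFrameOnTree`: per datum SOME frame `(Ω_K ≠ 0, ‖Ω_p‖ = 1, Q ∈ 𝓞_{ℂ_p}⟦T⟧)` with
Castella's interpolation and `Ch_Λ(X_ac)·𝓞_{ℂ_p}⟦T⟧ ⊆ (Q)` — to be free of the `R₀`-rationality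
question (x11b3-lit1 L59). Is anything LOST against the erratum's own display "(2.4)
`Ch_Λ(X_ac) ⊆ (L_p(f))` in `Λ_{R₀}`"? No:

* the extension `R₀⟦T⟧ → 𝓞_{ℂ_p}⟦T⟧` REFLECTS membership in principal ideals (value descent,
  `X11b/UnrSeriesIdealDescent.lean`: `ideal_map_toUnr_le_span_of_map_toCpInt_le`), and ideal rigidity
  across periods (multr1-p1's `R1.span_singleton_eq_of_isBDPLFunctionInt`, `X11b/FrameIdealRigidity.lean`)
  moves the ♭-divisibility between frames; hence
* §2 **`P2.IMCDivAllUnrFramesOnTree W p`** — (2.4) for EVERY `R₀`-frame `(Ω_K ≠ 0, Ω_p ∈ R₀ˣ,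
  L ∈ R₀⟦T⟧)` with `IsBDPLFunction ι' 𝔭_{ι'} κ γ f_{Dt} Ω_K Ω_p L`: the erratum's display VERBATIM
  whatever the normalisation (gen 23's `P2.IMCDivOnTree` CORRECTED by the binder `Ω_K ≠ 0` — without it
  the degenerate frame `(0, L = 0)` makes that shape refutable, `X11b/BDPRouteOpenInputDegenerateFrame.lean`
  — and with `f = f_{Dt}`; the `p ≥ 5` twin of x11b3's `Three.IMCDivAt₃`);
* §3 **`P2.imcDivAllUnrFramesOnTree_of_imcDivSomeFrame`**: (2.4)∃♭ ⟹ (2.4)∀ over `Λ_{R₀}` on EVERY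
  pair, unconditionally; `P2.imcDivAllUnrFramesOnTree_of_imcDivAllFrames` ((2.4)∀♭ ⟹ (2.4)∀ over
  `Λ_{R₀}`, descent alone); `P2.imcDivAllUnrFramesOnTree_of_imcDivOnTree` (the old shape implies the
  corrected one); conversely, where an `R₀`-frame EXISTS — gen 23's PUB shape `P2.BDPValueOnTree`
  (Cas18 Thms. 3.1–3.2; a THEOREM on semistable pairs, `P2.bdpValueOnTree_of_thm32_of_semistable`) —
  the `R₀`-∀-shape gives (2.4)∃♭ back: `P2.imcDivSomeFrameOnTree_of_imcDivAllUnrFrames_of_bdpValueOnTree`,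
  **`P2.imcDivSomeFrameOnTree_iff_imcDivAllUnrFrames_of_thm32_of_semistable`**.

* §4 (appended) the HONEST halves: **`P2.imcDivIntFrameOnTree_of_bdpValueOnTree_of_imcDivAllUnrFrames`**
  (H∃♭ ⟸ gen 23's PUB value shape `P2.BDPValueOnTree` + (2.4)∀ over `Λ_{R₀}`) and
  `P2.imcDivIntFrameOnTree_of_thm32_of_semistable_of_imcDivAllUnrFrames` (semistable: H∃♭ ⟸ `h32` +
  (2.4)∀ over `Λ_{R₀}`) — the replacements of the gen-23/24 bridges whose hypothesis
  `(h3 : P2.IMCDivOnTree W p)` is refutable (`X11b/BDPRouteOpenInputDegenerateFrame.lean`).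

HONEST READING for the registry (no fact filed, no mark): route p2's ONE open statement stays
(2.4)∃♭ `P2.IMCDivSomeFrameOnTree`; it IMPLIES the erratum's (2.4) for every honest `R₀`-frame of
Castella's published `L_p(f)` and is EQUIVALENT to that print-currency ∀-shape on the 753 185
semistable pairs (Cas18 3.1–3.2, PUBLISHED). With `X11b/BDPRouteOpenInputIdealRigidity.lean` (gen 26):
∃♭ ⟺ ∀♭ ⟺ ∀-Hsieh-witness (given Hsieh 2014 Thm. 1) ⟹ ∀-`R₀`. CONDITIONAL; nothing booked; labels
UNCHANGED; X11b stays CONSTRUCTION-SHAPED.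

References: [Castella2018] §1 (1.b) (p. 3), p. 4, Thm. 3.1, §2.2, §3 (arXiv:1704.06608 pp. 5, 9);
[Castella2018Erratum] (2.4) (p. 4); [FouquetWan2021] Thm. 4.41 (arXiv:2107.13726v3 p. 44; PREPRINT);
[Castella2024] Thm. 3.1 (arXiv:2409.01360; PREPRINT); [BurungaleCastellaSkinner2025] Thm. 1.2.4;
[SkinnerZhang2014] Thm. 1.2 (PREPRINT); [Cassels1986] Ch. 4.
-/

noncomputable section

open scoped Classical Topology NumberField

open Filter WeierstrassCurve NumberField IsDedekindDomain Field PowerSeries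
open Literature.NumberTheory.EllipticCurves Literature.NumberTheory.EllipticCurves.GreenbergSelmer
open Literature.NumberTheory.EllipticCurves.ModularForms
open Literature.NumberTheory.EllipticCurves.Rank1Residual
open Literature.NumberTheory.EllipticCurves.Rank1Residual.Typed
open Literature.NumberTheory.EllipticCurves.Castella2018
open Literature.NumberTheory.QuadraticFields.Quadratic
open Literature.NumberTheory.GaloisRepresentations Literature.NumberTheory.GaloisCohomology
open Literature.NumberTheory.LFunctions.Dwork (norm_natCast_p_padicComplex)
open Summit.BirchSwinnertonDyer.Rank1Residual.X11b.AcSelmer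
open Summit.BirchSwinnertonDyer.Rank1Residual.X11b.Halves

namespace Summit.BirchSwinnertonDyer.Rank1Residual.X11b

/-! ### §2 The print-currency ∀-shape (erratum (2.4) for every `R₀`-frame) -/

section Shape

variable (W : WeierstrassCurve ℚ) [W.IsElliptic] [W.IsGloballyMinimal] (p : ℕ) [Fact p.Prime]

/-- **(2.4)∀ over `Λ_{R₀}` — the erratum's divisibility for EVERY `R₀`-frame (OPEN shape, print
currency).** At every datum of `P2.IMCDivSomeFrameOnTree W p` (binders verbatim): for EVERY frame
`(Ω_K ≠ 0, Ω_p ∈ R₀ˣ, L ∈ R₀⟦T⟧ = Λ_{R₀})` with Castella's interpolation property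
`IsBDPLFunction ι' 𝔭_{ι'} κ γ f_{Dt} Ω_K Ω_p L` [Thm. 3.1; by frame rigidity `L` is THE `L_p(f)` in the
normalisation `(Ω_K, Ω_p)`], `Ch_Λ(X_ac^∅(E[p^∞]))·Λ_{R₀} ⊆ (L)` [the display (2.4) of the erratum
TRANSCRIBED to these classical data — NO announced derivation here: the erratum's "(2.4) ⇐ [FW21,
Thm. 4.41]" needs a prime `q ∥ N` NOT split in `K` (file docstring, SCOPE, gen 29)]. This is gen 23's
`P2.IMCDivOnTree` CORRECTED by the binder `Ω_K ≠ 0` (without it the degenerate frame `(0, L = 0)` makes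
the shape refutable: `P2.not_imcDivOnTree_of_facts`) and with `f = f_{Dt}`; the `p ≥ 5` twin of
x11b3's `Three.IMCDivAt₃`. Implied by (2.4)∃♭ outright (`P2.imcDivAllUnrFramesOnTree_of_imcDivSomeFrame`,
descent + ideal rigidity); equivalent to it where an `R₀`-frame exists (semistable pairs). An instance
of the Iwasawa–Greenberg main conjecture for `X_ac(E[p^∞])` (one inclusion) at `p ∥ N` and classical
Heegner fields — the multiplicative analogue of [BurungaleCastellaSkinner2025, Thm. 1.2.4] (good
ordinary `p`), not in print; a predicate on `(W, p)`; OPEN; NEVER a theorem in this cell; every result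
using it is CONDITIONAL. (Gens 26–28 badged it as claimed-by-the-erratum — withdrawn gen 29: the
erratum does not state (2.4) at these data.)
[cite: Castella2018, §1 (1.b) (arXiv:1704.06608 p. 3) and Thm. 3.1, display (3.2) (p. 9) (conjecture display and frame; shape only; nothing asserted)]
[cite: Castella2018Erratum, (2.4) (p. 4) (display transcribed; its derivation there assumes a prime of N non-split in K; nothing asserted)] -/
@[conjecture]
def P2.IMCDivAllUnrFramesOnTree : Prop :=
  ∀ (N : ℕ) [NeZero N] (K : Type) [Field K] [NumberField K]
    (Dt : ModularParametrizationData W N) (H : HeegnerDatum N (NumberField.discr K)) (ι : K →+* ℂ)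
    (P : (W.baseChange K).toAffine.Point),
    ClassX11b W p → 5 ≤ p → Surj W p → W.conductorNorm ℤ = N → IsImaginaryQuadratic K →
    Odd (NumberField.discr K) → ¬ (p : ℤ) ∣ NumberField.discr K → ¬ p ∣ Units.torsionOrder K →
    SatisfiesHeegnerHypothesis N K →
    (W.quadraticTwist (NumberField.discr K : ℚ)).entireLFunction 1 ≠ 0 →
    WeierstrassCurve.Affine.Point.map ι.toRatAlgHom P = heegnerPointComplex Dt H →
    ¬ (p : ℤ) ∣ Dt.c → ¬ IsOfFinAddOrder P →
    ∀ (κ : ZpExtension K p), κ.IsAnticyclotomic →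
      ∀ (γ : Field.absoluteGaloisGroup K) [Fact (κ.IsTopGenerator γ)]
        (ι' : PadicAlgCl p ≃+* ℂ) (w₀ : InfinitePlace K) (P' : (W.baseChange K).toAffine.Point),
        WeierstrassCurve.Affine.Point.map w₀.embedding.toRatAlgHom P' = heegnerPointComplex Dt H →
        ∀ (e : K →+* ℚ_[p]),
          (∀ k : 𝓞 K, k ∈ (primeOfEmbeddingDatum p ι' w₀.embedding).asIdeal ↔ ‖e (k : K)‖ < 1) →
          ∀ (ΩK : ℂ) (Ωp : (unrIntegers p)ˣ) (L : UnrSeries p), ΩK ≠ 0 →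
            IsBDPLFunction ι' (primeOfEmbeddingDatum p ι' w₀.embedding) κ γ Dt.f ΩK
              ((Ωp : unrIntegers p) : ℂ_[p]) L →
            (XAc.charIdeal (W.baseChange K) p κ (primeOfEmbeddingDatum p ι' w₀.embedding) ∅ γ).map
              (PowerSeries.map (toUnr p)) ≤ Ideal.span {L}

end Shape

/-! ### §3 Links with (2.4)∃♭ and with gen 23's shapes -/

section Links

variable {W : WeierstrassCurve ℚ} [W.IsElliptic] [W.IsGloballyMinimal] {p : ℕ} [Fact p.Prime]

/-- A unit of `R₀`, read in `ℂ_p`, is non-zero (it has norm `1`). [folklore] -/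
theorem coe_units_unrIntegers_ne_zero (u : (unrIntegers p)ˣ) : ((u : unrIntegers p) : ℂ_[p]) ≠ 0 :=
  fun h ↦ by
    have h1 := norm_coe_units_unrIntegers p u
    rw [h, norm_zero] at h1
    exact zero_ne_one h1

omit [W.IsElliptic] [W.IsGloballyMinimal] in
/-- **(2.4)∃♭ ⟹ (2.4) for EVERY `R₀`-frame, on EVERY pair** (the erratum's display verbatim): read the
`R₀`-frame in `𝓞_{ℂ_p}⟦T⟧` (`R1.isBDPLFunctionInt_map`), move the ♭-divisibility to it by ideal
rigidity across periods (`p ≠ 2` from X11b, `K` imaginary quadratic, `κ` anticyclotomic, `γ` a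
topological generator — binders of the datum), and DESCEND along `R₀⟦T⟧ → 𝓞_{ℂ_p}⟦T⟧` (§1).
CONDITIONAL on (2.4)∃♭; nothing booked. [claim: Castella2018Erratum, status: under-review]
[cite: Castella2018, Thm. 3.1 and §3 (arXiv:1704.06608 p. 9)] -/
theorem P2.imcDivAllUnrFramesOnTree_of_imcDivSomeFrame (hD : P2.IMCDivSomeFrameOnTree W p) :
    P2.IMCDivAllUnrFramesOnTree W p := by
  intro N _ K _ _ Dt H ιK P hX h5 hs hN hK hodd hpd hμ hHN hLt hP hc hPinf κ hκ γ hγ ι' w₀ P' hP' e he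
    ΩK' Ωp' L hΩK' hL
  obtain ⟨ΩK, Ωp, Q, hΩK, hΩp, hQ, hdiv⟩ :=
    hD N K Dt H ιK P hX h5 hs hN hK hodd hpd hμ hHN hLt hP hc hPinf κ hκ γ ι' w₀ P' hP' e he
  have hΩp0 : Ωp ≠ 0 := fun h ↦ by rw [h, norm_zero] at hΩp; exact zero_ne_one hΩp
  have hL' := R1.isBDPLFunctionInt_map hL
  refine ideal_map_toUnr_le_span_of_map_toCpInt_le _ L ?_
  rwa [R1.span_singleton_eq_of_isBDPLFunctionInt hX.2.1 hK hκ hγ.out hΩK hΩK' hΩp0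
    (coe_units_unrIntegers_ne_zero Ωp') hQ hL']

omit [W.IsElliptic] [W.IsGloballyMinimal] in
/-- **(2.4)∀♭ ⟹ (2.4)∀ over `Λ_{R₀}`** (gen 26's ♭-∀-shape `P2.IMCDivAllFramesOnTree`, file
`X11b/BDPRouteOpenInputIdealRigidity.lean`): read the `R₀`-frame in `𝓞_{ℂ_p}⟦T⟧` and DESCEND — no
rigidity needed in this direction. With that file: (2.4)∃♭ ⟺ (2.4)∀♭ ⟺ (2.4)-for-every-Hsieh-witness
(given Hsieh 2014 Thm. 1) ⟹ (2.4)∀ over `Λ_{R₀}`. CONDITIONAL; nothing booked.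
[claim: Castella2018Erratum, status: under-review] [cite: Castella2018, Thm. 3.1 and §3 (arXiv:1704.06608 p. 9)] -/
theorem P2.imcDivAllUnrFramesOnTree_of_imcDivAllFrames (hA : P2.IMCDivAllFramesOnTree W p) :
    P2.IMCDivAllUnrFramesOnTree W p := by
  intro N _ K _ _ Dt H ιK P hX h5 hs hN hK hodd hpd hμ hHN hLt hP hc hPinf κ hκ γ _ ι' w₀ P' hP' e he
    ΩK Ωp L hΩK hL
  exact ideal_map_toUnr_le_span_of_map_toCpInt_le _ L
    (hA N K Dt H ιK P hX h5 hs hN hK hodd hpd hμ hHN hLt hP hc hPinf κ hκ γ ι' w₀ P' hP' e he ΩK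
      ((Ωp : unrIntegers p) : ℂ_[p]) (PowerSeries.map (R1.unrToCpInt p) L) hΩK
      (coe_units_unrIntegers_ne_zero Ωp) (R1.isBDPLFunctionInt_map hL))

omit [W.IsElliptic] [W.IsGloballyMinimal] in
/-- Gen 23's `P2.IMCDivOnTree W p` (all `Ω_K`, all newforms of `E`) implies the corrected shape
(restrict to `Ω_K ≠ 0` and `f = f_{Dt}`, `Dt.isNewformOf`). Recorded for completeness only: the
antecedent is refutable (`P2.not_imcDivOnTree_of_facts`). [claim: Castella2018Erratum, status: under-review] -/
theorem P2.imcDivAllUnrFramesOnTree_of_imcDivOnTree (h : P2.IMCDivOnTree W p) :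
    P2.IMCDivAllUnrFramesOnTree W p :=
  fun N _ K _ _ Dt H ιK P hX h5 hs hN hK hodd hpd hμ hHN hLt hP hc hPinf κ hκ γ _ ι' w₀ _P' _hP' _e _he
      ΩK Ωp L _hΩK hL ↦
    h N K Dt H ιK P hX h5 hs hN hK hodd hpd hμ hHN hLt hP hc hPinf κ hκ γ Dt.f Dt.isNewformOf ι' w₀
      ΩK Ωp L hL

/-- **Where an `R₀`-frame EXISTS, the print-currency ∀-shape gives (2.4)∃♭ back**: gen 23's PUB shape
`P2.BDPValueOnTree W p` (per datum an `R₀`-frame `(Ω_K ≠ 0, Ω_p ∈ R₀ˣ, L)` with Cas18 3.1 ∧ 3.2; a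
THEOREM on semistable pairs) + (2.4)∀ over `Λ_{R₀}` ⟹ `P2.IMCDivSomeFrameOnTree W p` (read the frame
in `𝓞_{ℂ_p}⟦T⟧`; `‖Ω_p‖ = 1`). CONDITIONAL on both shapes; nothing booked.
[cite: Castella2018, Thms. 3.1–3.2 (arXiv:1704.06608 p. 9)] [claim: Castella2018Erratum, status: under-review] -/
theorem P2.imcDivSomeFrameOnTree_of_imcDivAllUnrFrames_of_bdpValueOnTree
    (h2 : P2.BDPValueOnTree W p) (hA : P2.IMCDivAllUnrFramesOnTree W p) :
    P2.IMCDivSomeFrameOnTree W p := by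
  intro N _ K _ _ Dt H ιK P hX h5 hs hN hK hodd hpd hμ hHN hLt hP hc hPinf κ hκ γ _ ι' w₀ P' hP' e he
  obtain ⟨ΩK, Ωp, L, hΩK, hL, -⟩ :=
    h2 N K Dt H ιK P hX h5 hs hN hK hodd hpd hμ hHN hLt hP hc hPinf κ hκ γ ι' w₀ P' hP' e he
  have hdiv := hA N K Dt H ιK P hX h5 hs hN hK hodd hpd hμ hHN hLt hP hc hPinf κ hκ γ ι' w₀ P' hP' e he
    ΩK Ωp L hΩK hL
  exact ⟨ΩK, ((Ωp : unrIntegers p) : ℂ_[p]), PowerSeries.map (R1.unrToCpInt p) L, hΩK,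
    norm_coe_units_unrIntegers p Ωp, R1.isBDPLFunctionInt_map hL,
    ideal_map_toCpInt_le_span_of_map_toUnr_le _ L hdiv⟩

/-- **(2.4)∃♭ ⟺ (2.4)∀ over `Λ_{R₀}`, given gen 23's PUB frame-existence shape `P2.BDPValueOnTree`.**
[cite: Castella2018, Thms. 3.1–3.2 (arXiv:1704.06608 p. 9)] [claim: Castella2018Erratum, status: under-review] -/
theorem P2.imcDivSomeFrameOnTree_iff_imcDivAllUnrFrames_of_bdpValueOnTree
    (h2 : P2.BDPValueOnTree W p) :
    P2.IMCDivSomeFrameOnTree W p ↔ P2.IMCDivAllUnrFramesOnTree W p :=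
  ⟨P2.imcDivAllUnrFramesOnTree_of_imcDivSomeFrame,
    P2.imcDivSomeFrameOnTree_of_imcDivAllUnrFrames_of_bdpValueOnTree h2⟩

/-- **On SEMISTABLE pairs: (2.4)∃♭ ⟺ the erratum's (2.4) for every `R₀`-frame**, from Cas18 Thms.
3.1–3.2 (`h32`, PUBLISHED; gen 23's `P2.bdpValueOnTree_of_thm32_of_semistable`). So on the 753 185
semistable X11b pairs route p2's one open statement IS the erratum's display, read for any (every)
normalisation of Castella's published `L_p(f)`. CONDITIONAL on nothing but `h32`; nothing booked.
[cite: Castella2018, Thms. 3.1–3.2 (arXiv:1704.06608 p. 9)] [claim: Castella2018Erratum, status: under-review] -/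
theorem P2.imcDivSomeFrameOnTree_iff_imcDivAllUnrFrames_of_thm32_of_semistable
    (h32 : thm32_exists_isBDPLFunction_valueAtOne) (hss : Semistable W) :
    P2.IMCDivSomeFrameOnTree W p ↔ P2.IMCDivAllUnrFramesOnTree W p :=
  P2.imcDivSomeFrameOnTree_iff_imcDivAllUnrFrames_of_bdpValueOnTree
    (P2.bdpValueOnTree_of_thm32_of_semistable h32 hss)

end Links

/-! ### §4 (appended, gen 26) The honest halves: H∃♭ from the PUB value shape + (2.4)∀ over `Λ_{R₀}` -/

section Halves

variable {W : WeierstrassCurve ℚ} [W.IsElliptic] [W.IsGloballyMinimal] {p : ℕ} [Fact p.Prime]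

/-- **H∃♭ from the two HONEST halves**: gen 23's PUB shape `P2.BDPValueOnTree W p` (Cas18 Thms. 3.1 ∧
3.2 for some `R₀`-frame at each datum) and the corrected print-currency ∀-shape
`P2.IMCDivAllUnrFramesOnTree W p` give route p2's H∃♭ `P2.IMCDivIntFrameOnTree W p` (the `R₀`-frame
read in `𝓞_{ℂ_p}⟦T⟧` carries 3.1♭, 3.2♭ and — by the ∀-shape — (2.4)♭). This REPLACES the gen-23/24
bridges `P2.imcDivFrameOnTree_of_halves` / `P2.imcDivIntFrameOnTree_of_halves (h2) (h3)`, whose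
hypothesis `(h3 : P2.IMCDivOnTree W p)` is refutable (`P2.not_imcDivOnTree_of_facts`). CONDITIONAL on
both shapes; nothing booked. [cite: Castella2018, Thms. 3.1–3.2 (arXiv:1704.06608 p. 9)]
[claim: Castella2018Erratum, status: under-review] -/
theorem P2.imcDivIntFrameOnTree_of_bdpValueOnTree_of_imcDivAllUnrFrames
    (h2 : P2.BDPValueOnTree W p) (hA : P2.IMCDivAllUnrFramesOnTree W p) :
    P2.IMCDivIntFrameOnTree W p :=
  P2.imcDivIntFrameOnTree_of_someFrames
    (P2.imcDivSomeFrameOnTree_of_imcDivAllUnrFrames_of_bdpValueOnTree h2 hA)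
    (P2.bdpValueSomeFrameOnTree_of_bdpValueOnTree h2)

/-- **On SEMISTABLE pairs: H∃♭ from `h32` (Cas18 Thms. 3.1–3.2, PUBLISHED) + (2.4)∀ over `Λ_{R₀}`**
— the honest form of gen 24's `P2.imcDivIntFrameOnTree_of_thm32_of_semistable_of_imcDiv`.
CONDITIONAL on `h32` and the ∀-shape; nothing booked. [cite: Castella2018, Thms. 3.1–3.2 (arXiv:1704.06608 p. 9)]
[claim: Castella2018Erratum, status: under-review] -/
theorem P2.imcDivIntFrameOnTree_of_thm32_of_semistable_of_imcDivAllUnrFrames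
    (h32 : thm32_exists_isBDPLFunction_valueAtOne) (hss : Semistable W)
    (hA : P2.IMCDivAllUnrFramesOnTree W p) : P2.IMCDivIntFrameOnTree W p :=
  P2.imcDivIntFrameOnTree_of_bdpValueOnTree_of_imcDivAllUnrFrames
    (P2.bdpValueOnTree_of_thm32_of_semistable h32 hss) hA

end Halves

end Summit.BirchSwinnertonDyer.Rank1Residual.X11b

end
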